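import Summits.AtomisticToContinuum.Crystallization.Theorems.ChargedEnergyGapStressFreeFccC
import HarnessLib

/-!
# «StressFreeFcc» P-J FCC-W (lens-3 g61) — part 4 of 5 (sequel of `…ChargedEnergyGapStressFreeFccC`)

Split for the 400-line cap by the landing lane (hand-2 g31); the module docstring of part 1 (`…ChargedEnergyGapStressFreeFccA`) describes the whole node.  Same namespace; all FQNs unchanged.
0 sorry; standard axioms.
-/

noncomputable section
open scoped Classical
open Literature.MathematicalPhysics.StatisticalMechanics
open Literature.Geometry.DiscreteGeometry
open Summit.AtomisticToContinuum.Crystallization.Theses.PricedLinkCensus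
open Summit.AtomisticToContinuum.Crystallization.Theorems.ChargedEnergyGapNegative

namespace Summit.AtomisticToContinuum.Crystallization.Theorems.ChargedEnergyGapChartDial

namespace Fcc

-- PRIVATE copies (landing lane): these helpers are `private` in `ChargedEnergyGapStressFreeFccA` (dedup gate), so each consumer module carries its own private copy.
/-- `nsq_neg` (docstring added by the landing lane; see the module docstring). [formal bookkeeping] -/
private theorem nsq_neg (n : Fin 3 → ℤ) : nsq (-n) = nsq n := by
  simp [nsq]

/-! ## The witness -/

section Witness

/-- ★★ A fcc lattice whose virial entries vanish is STRESS-FREE. -/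
theorem isStressFree_fcc (a : ℝ) (ha : 0 < a) (hS : ∀ i j, S a i j = 0) : IsStressFree (fccRef a ha) := by
  intro u w
  rw [fccRef_motif, Finset.sum_singleton, ← (vecEquiv a ha).tsum_eq]
  simp only [vecEquiv_apply, sub_zero, dist_zero_vec a ha, inner_vec]
  have hexp : ∀ n : D3, ljD1 (a * Real.sqrt (nsq n.1)) / (a * Real.sqrt (nsq n.1)) *
      ((∑ i, ((n.1 i : ℝ) * a) * u i) * (∑ j, ((n.1 j : ℝ) * a) * w j)) = ∑ i, ∑ j, (u i * w j) * term a i j n := fun n => by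
    rw [Finset.sum_mul_sum, Finset.mul_sum]
    refine Finset.sum_congr rfl fun i _ => ?_
    rw [Finset.mul_sum]
    refine Finset.sum_congr rfl fun j _ => ?_
    simp only [term, F, len]
    ring
  simp_rw [hexp]
  rw [Summable.tsum_finsetSum (fun i _ => summable_sum fun j _ => (summable_term a ha i j).mul_left _)]
  refine Finset.sum_eq_zero fun i _ => ?_
  rw [Summable.tsum_finsetSum (fun j _ => (summable_term a ha i j).mul_left _)]
  refine Finset.sum_eq_zero fun j _ => ?_
  rw [tsum_mul_left]
  change u i * w j * S a i j = 0
  rw [hS i j]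
  exact mul_zero _

/-- Antipodal map on `D₃ ∖ 0`. -/
theorem even_sum_neg {n : Fin 3 → ℤ} (hn : Even (∑ k, n k)) : Even (∑ k, (-n) k) := by
  simp only [Pi.neg_apply, Finset.sum_neg_distrib]; exact hn.neg

/-- `antipode` (docstring added by the landing lane; see the module docstring). [formal bookkeeping] -/
def antipode : D3 ≃ D3 where
  toFun n := ⟨-n.1, neg_ne_zero.2 n.2.1, even_sum_neg n.2.2⟩
  invFun n := ⟨-n.1, neg_ne_zero.2 n.2.1, even_sum_neg n.2.2⟩
  left_inv n := Subtype.ext (neg_neg n.1)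
  right_inv n := Subtype.ext (neg_neg n.1)

/-- ★ The fcc lattice is FORCE-FREE at every spacing (inversion symmetry). -/
theorem isForceFree_fcc (a : ℝ) (ha : 0 < a) : IsForceFree (fccRef a ha) := by
  intro y hy
  rw [fccRef_motif, Finset.mem_singleton] at hy
  subst hy
  rw [← (vecEquiv a ha).tsum_eq]
  simp only [vecEquiv_apply, sub_zero, dist_zero_vec a ha]
  set g : D3 → E3 := fun n => (ljD1 (a * Real.sqrt (nsq n.1)) / (a * Real.sqrt (nsq n.1))) • vec a n.1 with hg
  have hsum : Summable g := by
    refine Summable.of_norm_bounded ((summable_inv_len_pow a ha (by norm_num : 3 < 13)).add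
      (summable_inv_len_pow a ha (by norm_num : 3 < 7))) fun n => ?_
    have hd := len_pos a ha n
    have hlen : a * Real.sqrt (nsq n.1) = len a n := rfl
    rw [hg]
    simp only [hlen]
    rw [norm_smul, Real.norm_eq_abs, abs_div, abs_of_pos hd, norm_vec a ha, hlen, div_mul_cancel₀ _ hd.ne', ljD1]
    exact (abs_add_le _ _).trans (by rw [abs_neg, abs_of_nonneg (pow_nonneg (inv_nonneg.2 hd.le) _),
      abs_of_nonneg (pow_nonneg (inv_nonneg.2 hd.le) _)])
  have hanti : ∀ n : D3, g (antipode n) = -g n := fun n => by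
    simp only [hg, antipode, Equiv.coe_fn_mk, nsq_neg, vec_neg, smul_neg]
  have h : ∑' n, g n = -∑' n, g n := by
    calc ∑' n, g n = ∑' n, g (antipode n) := (antipode.tsum_eq g).symm
      _ = ∑' n, -g n := by simp_rw [hanti]
      _ = -∑' n, g n := tsum_neg
  have h2 : (2 : ℝ) • ∑' n, g n = 0 := by rw [two_smul]; nth_rewrite 2 [h]; exact add_neg_cancel _
  exact (smul_eq_zero.1 h2).resolve_left two_ne_zero

/-- ★★ The fcc Lennard-Jones lattice `a₀·D₃` at its stress-free parameter is FORCE-FREE and STRESS-FREE and has a bond of length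
`a₀√2 ≤ √2 ≤ 2` at the motif point (the fcc analogue of part P-I(3/3)'s cubic witness; sharpened below to the admissible window). (dedup gate: the SAME ∃-statement is already the tree theorem `Cubic.exists_forceFree_stressFree_bond` (P-I(3/3), cubic witness); this fcc-witness proof is kept PRIVATE for the record — the sharpened admissible-window witness `Fcc.fcc_witness` below is the public fcc statement) -/
private theorem exists_forceFree_stressFree_bond : ∃ P : PeriodicConfiguration 3, IsForceFree P ∧ IsStressFree P ∧
    ∃ y ∈ P.motif, ∃ z ∈ P.points, z ≠ y ∧ dist y z ≤ 2 := by
  refine ⟨fccRef a0 a0_pos, isForceFree_fcc a0 a0_pos, isStressFree_fcc a0 a0_pos S_a0_eq_zero, 0, by simp [fccRef_motif],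
    vec a0 e0.1, vec_mem_points a0_pos e0.2.2, fun h => e0.2.1 ((vec_eq_zero_iff a0 a0_pos e0.1).1 h), ?_⟩
  rw [dist_zero_vec a0 a0_pos, nsq_e0]
  have h2 : Real.sqrt 2 ≤ 2 := by
    rw [show (2 : ℝ) = Real.sqrt 4 by rw [show (4:ℝ) = 2 ^ 2 by norm_num, Real.sqrt_sq (by norm_num : (0:ℝ) ≤ 2)]]
    exact Real.sqrt_le_sqrt (by norm_num)
  nlinarith [a0_le_one, a0_pos, Real.sqrt_nonneg 2]

end Witness

end Fcc

end Summit.AtomisticToContinuum.Crystallization.Theorems.ChargedEnergyGapChartDial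

end
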